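import Mathlib
import Literature.MathematicalPhysics.QuantumFieldTheory.Balaban1983to89.B16Sect1Kernels

/-!
# `Balaban1983to89.B16Lem381Case2` — T. Bałaban, *Large field renormalization. II. Localization, exponentiation, and
bounds for the 𝐑 operation*, Commun. Math. Phys. **122** (1989) 355–392 [Balaban1989LargeFieldII], Sect. 1
pp. 382–383: CASE 2 of the small factor from the function `1 − χ′` (SKELETON row **B16.Lem@381**, last clause «case 2
→ (1.77)–(1.78)») — the p. 383 sentence *"We take the bond b, for which |B(b)| ≧ g_j⁻¹δ′_j = A₁p₁(g_j), and the
inequalities (1.77), (1.78) yield the following large field factor: exp(−½γ₀[6(d + 3)(100M(L + 1)N^{β₀}R_j)^{d+2}]⁻¹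
A₁²p₁²(g_j)) < exp(−R_j^{−d−5}p₁²(g_j)). … and we estimate the factors by exp(−p₀(g_j))"* PROVED as a mechanism-level
model: the Gaussian `B`-integral restricted to the large-bond region is bounded by that factor (times the harmless
`e^{½c}` of the (1.77) constant and the total weight), from (1.77) and (1.78) taken BY NAME as the pointwise typed leaves
`…B16Sect1Kernels.Ineq177`/`Ineq178`; complements the object-level CASE 1 of unit p26 (`…B16Ineq382Case1`,
`…B16Ineq382WilsonFactor`)

statement-level skeleton of published theorems with citation tags; proofs where landed; nothing here is a claim about
the Yang–Mills mass gap

PDF held: `paper:balaban1989-cmp122-large-field-ii` (journal page = PDF page + 354).  The sentences quoted were READ AS AN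
IMAGE by this seat on the x2 renders `run/shared/lean/pub/pub-balaban/b2b-balaban-ref1/pages/1989-cmp122-large-field-II/…-p028,p029-x2.png`
(pp. 382–383).

CITATION HEADER / WHAT IS REPRODUCED (mega-formalization `lit-balaban`, reader/typer r13 gen 7; HOME
`run/shared/lean/pub/lit-balaban/`, rows `lit-balaban-r13/ROWS-B16.md` v2.23): SKELETON row **B16.Lem@381** (cell: case 1
complete at object level — p26 p247140 … p249376; «case 2 → rows B16.Eq1.77/1.78»: (1.78) PROVED twice (r13 g5 p248131,
p248296), (1.77) a typed leaf, the link `form_lower_of_large_bond` and the exponent comparison `lfFactor178` typed in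
`…B16Sect1Kernels` (r13 g1), the comparison PROVED under the explicit largeness of `R_j` in the pending v5
(`lfFactor178_of_large`, p251908)).

WHAT IS PRINTED (p. 382 [PDF 28] – p. 383 [PDF 29], verbatim).  *"Consider now the second case, i.e., we assume that
|B′| < δ′_j on Ω″˜²_{h+1}∖Ω″_{h+1}, but |B′(b)| ≧ δ′_j for a bond b ∈ Ω″_{h+1} ∩ 𝐁₀. To get a small factor in this case, we
use the quadratic form in the expansion (1.20). … Using the local version of the bound (1.7) we can bound this quadratic
form from below by γ₀ Σ_{p′∈𝐁₀∩Ω″˜_{h+1}} |(∂B)(p′)|². Thus we obtain the inequality [(1.77)] … For the quadratic form on the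
right-hand side we have an inequality similar to (1.8), but now we need a simpler inequality. We have to bound one bond
variable |B(b)|² by the quadratic form. … [(1.78)] for a bond b ∈ 𝐁₀∩Ω″˜_{h+1}. We take the bond b, for which |B(b)| ≧
g_j⁻¹δ′_j = A₁p₁(g_j), and the inequalities (1.77), (1.78) yield the following large field factor:
exp(−½γ₀[6(d + 3)(100M(L + 1)N^{β₀}R_j)^{d+2}]⁻¹A₁²p₁(g_j)) < exp(−R_j^{−d−5}p₁²(g_j)). This is the largest factor among
all the small factors we have obtained from the large field characteristic functions in the preparatory steps. We assume
that 2p₁ − (d + 5)r₀ > p₀, and we estimate the factors by exp(−p₀(g_j))."*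

HOW IT IS MODELLED (ref-1 F6; the dictionary).  `Ω` = the space of the integration variables `B` of the `B`-integral of
(1.70)/(1.71) with its measure `μ` (`dB` with the gauge-fixing `δ_{T₀}(B)`; abstract measure space); `w ≥ 0` = the
remaining density factors `σ(g_kB)χ′…` (bounded weight); `Q B` = the quadratic form `⟨DH″_{1,j,Z}B, ζDH″_{1,j,Z}B⟩`; `ndB B`
= `Σ_{p′∈𝐁₀∩Ω″˜_{h+1}}|(∂B)(p′)|²`; `nb B` = `|B(b)|²` at the chosen bond; `R` = the region carved out by `1 − χ′` in case 2,
on which `|B(b)| ≧ A₁p₁(g_j)` (`hR`); (1.77) and (1.78) hold pointwise on `R` in their typed forms `Ineq177`, `Ineq178`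
(`h77`, `h78` — the leaves, NOT proved here); `W = 6(d+3)(100M(L+1)N^{β₀}R_j)^{d+2}` (`W178`), `c` = the (1.77) constant
`O(1)A₀A₁²B₃⁴B₅M^{d+6}R_j^{d+3}p₀(g_j)p₁²(g_j)g_j` (`c177`; p. 383: *"We assume that g_j is sufficiently small, so that the
constant … is small, or O(1)"*).
* §1 `exp_neg_half_form_le` — pointwise on `R`: `e^{−½Q(B)} ≦ e^{½c}·exp(−½γ₀W⁻¹A₁²p₁²(g_j))` ((1.77) + (1.78) + the
  chosen bond, through r13's `form_lower_of_large_bond`).  PROVED.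
* §2 `case2Integral_le` — integrated: `∫_R w e^{−½Q} dμ ≦ e^{½c}·exp(−½γ₀W⁻¹A₁²p₁²(g_j))·∫_R w dμ` (Mathlib
  `setIntegral_mono_on`; if the left integrand is not integrable the Bochner integral is `0` and the bound is trivial).
  PROVED.
* §3 `case2Integral_lt_printed` / `case2Integral_le_exp_neg_p0` — with the displayed comparison `lfFactor178` (in the
  corrected `p₁²` reading; a hypothesis here, = `lfFactor178_of_large` of the v5 of `…B16Sect1Kernels` under the explicit
  largeness of `R_j`) the factor is `< exp(−R_j^{−d−5}p₁²(g_j))`, and with the exponent proviso of p. 383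
  (`ExponentProviso383`, through r13's `exp_lfFactor_le_exp_neg_p0`) it is `≦ exp(−p₀(g_j))` — *"we estimate the factors by
  exp(−p₀(g_j))"*.  PROVED.
NOT HERE: (1.77) itself (leaf; the local version of (1.7)), the identification of `R` with the support of `1 − χ′` in
case 2 and the axial/Landau regauging of pp. 382–383 that precedes (1.77), the value of `∫_R w dμ` (≦ the total weight,
estimated by `1` in print).  No `sorry`, no axiom; nothing printed is asserted as a fact.
-/

open MeasureTheory Set

namespace Literature.MathematicalPhysics.QuantumFieldTheory.Balaban1983to89.B16Lem381Case2

open B16Sect1Kernels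

noncomputable section

/-- `W = 6(d + 3)(100M(L + 1)N^{β₀}R_j)^{d+2}` — the constant of (1.78) p. 383 (`Nβ` = `N^{β₀}`). [cite: Balaban1989LargeFieldII, (1.78) p.383] -/
def W178 (M L Nβ Rj : ℝ) (d : ℕ) : ℝ := 6 * (d + 3) * (100 * M * (L + 1) * Nβ * Rj) ^ (d + 2)

/-- `c = O(1)A₀A₁²B₃⁴B₅M^{d+6}R_j^{d+3}p₀(g_j)p₁²(g_j)g_j` — the constant subtracted in (1.77) p. 383 (the `O(1)` explicit as
`C`); p. 383: *"We assume that g_j is sufficiently small, so that the constant on the right-hand side above is small, or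
O(1)."* [cite: Balaban1989LargeFieldII, (1.77) p.383] -/
def c177 (C A₀ A₁ B₃ B₅ M Rj p₀g p₁g gj : ℝ) (d : ℕ) : ℝ :=
  C * A₀ * A₁ ^ 2 * B₃ ^ 4 * B₅ * M ^ (d + 6) * Rj ^ (d + 3) * p₀g * p₁g ^ 2 * gj

/-- (1.78) in the typed form `Ineq178` IS `nb ≤ W178 · ndB`. Bookkeeping. [cite: Balaban1989LargeFieldII, (1.78) p.383] -/
theorem ineq178_iff (nb ndB M L Nβ Rj : ℝ) (d : ℕ) :
    Ineq178 nb ndB M L Nβ Rj d ↔ nb ≤ W178 M L Nβ Rj d * ndB := Iff.rfl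

/-- (1.77) in the typed form `Ineq177` IS `γ₀·ndB − c177 < Q`. Bookkeeping. [cite: Balaban1989LargeFieldII, (1.77) p.383] -/
theorem ineq177_iff (Q ndB γ₀ C A₀ A₁ B₃ B₅ M Rj p₀g p₁g gj : ℝ) (d : ℕ) :
    Ineq177 Q ndB γ₀ C A₀ A₁ B₃ B₅ M Rj p₀g p₁g gj d ↔ γ₀ * ndB - c177 C A₀ A₁ B₃ B₅ M Rj p₀g p₁g gj d < Q := by
  unfold Ineq177 c177; exact Iff.rfl

/-- `W > 0` for positive `M`, `L + 1`, `N^{β₀}`, `R_j`. [cite: Balaban1989LargeFieldII, (1.78) p.383] -/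
theorem W178_pos {M L Nβ Rj : ℝ} {d : ℕ} (h : 0 < 100 * M * (L + 1) * Nβ * Rj) : 0 < W178 M L Nβ Rj d := by
  unfold W178; positivity

/-! ## §1. Pointwise on the large-bond region: (1.77) + (1.78) bound the Gaussian factor -/

/-- **p. 383, the mechanism, pointwise**: at a configuration `B` where (1.77) holds (`h77`), (1.78) holds for the chosen
bond (`h78`) and that bond is large, `|B(b)|² ≧ (A₁p₁(g_j))²` (`hb`), the quadratic form satisfies `Q > γ₀W⁻¹A₁²p₁² − c`
(r13's `form_lower_of_large_bond`), hence the Gaussian factor obeys `e^{−½Q} ≦ e^{½c}·exp(−½γ₀W⁻¹A₁²p₁²(g_j))`. PROVED.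
[cite: Balaban1989LargeFieldII, p.383 (after (1.78))] -/
theorem exp_neg_half_form_le {Q ndB nb γ₀ C A₀ A₁ B₃ B₅ M L Nβ Rj p₀g p₁g gj : ℝ} {d : ℕ} (hγ : 0 ≤ γ₀)
    (hW : 0 < 100 * M * (L + 1) * Nβ * Rj) (h77 : Ineq177 Q ndB γ₀ C A₀ A₁ B₃ B₅ M Rj p₀g p₁g gj d)
    (h78 : Ineq178 nb ndB M L Nβ Rj d) (hb : (A₁ * p₁g) ^ 2 ≤ nb) :
    Real.exp (-(1 / 2) * Q) ≤
      Real.exp (1 / 2 * c177 C A₀ A₁ B₃ B₅ M Rj p₀g p₁g gj d) *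
        Real.exp (-(1 / 2) * γ₀ * (W178 M L Nβ Rj d)⁻¹ * A₁ ^ 2 * p₁g ^ 2) := by
  have hlow := form_lower_of_large_bond (W178_pos (d := d) hW) hγ ((ineq178_iff _ _ _ _ _ _ _).mp h78)
    ((ineq177_iff _ _ _ _ _ _ _ _ _ _ _ _ _ _).mp h77) hb
  rw [← Real.exp_add, Real.exp_le_exp]
  have : (A₁ * p₁g) ^ 2 = A₁ ^ 2 * p₁g ^ 2 := by ring
  rw [this] at hlow
  nlinarith

/-! ## §2. Integrated over the region: the large field factor of case 2 -/

variable {Ω : Type*} [MeasurableSpace Ω]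

/-- **pp. 382–383, case 2, the large field factor** (mechanism-level model): on a measure space `(Ω, μ)` of the
`B`-variables, for the region `R` of case 2 (on which some bond has `|B(b)| ≧ g_j⁻¹δ′_j = A₁p₁(g_j)`: `hb`), a weight
`0 ≦ w` integrable on `R`, and the quadratic form `Q` with (1.77), (1.78) pointwise on `R` (`h77`, `h78`): the restricted
Gaussian integral is bounded by the printed factor times `e^{½c}` and the total weight,
`∫_R w(B) e^{−½Q(B)} dμ ≦ e^{½c}·exp(−½γ₀[6(d+3)(100M(L+1)N^{β₀}R_j)^{d+2}]⁻¹A₁²p₁²(g_j))·∫_R w dμ`. PROVED (pointwise §1 +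
monotonicity of the integral; a non-integrable left integrand has Bochner integral `0`). [cite: Balaban1989LargeFieldII, p.383 (after (1.78))] -/
theorem case2Integral_le (μ : Measure Ω) {R : Set Ω} (hRm : MeasurableSet R) {w Q ndB nb : Ω → ℝ}
    {γ₀ C A₀ A₁ B₃ B₅ M L Nβ Rj p₀g p₁g gj : ℝ} {d : ℕ} (hγ : 0 ≤ γ₀) (hW : 0 < 100 * M * (L + 1) * Nβ * Rj)
    (hw0 : ∀ ω ∈ R, 0 ≤ w ω) (hwi : IntegrableOn w R μ)
    (h77 : ∀ ω ∈ R, Ineq177 (Q ω) (ndB ω) γ₀ C A₀ A₁ B₃ B₅ M Rj p₀g p₁g gj d)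
    (h78 : ∀ ω ∈ R, Ineq178 (nb ω) (ndB ω) M L Nβ Rj d) (hb : ∀ ω ∈ R, (A₁ * p₁g) ^ 2 ≤ nb ω) :
    ∫ ω in R, w ω * Real.exp (-(1 / 2) * Q ω) ∂μ ≤
      Real.exp (1 / 2 * c177 C A₀ A₁ B₃ B₅ M Rj p₀g p₁g gj d) *
        Real.exp (-(1 / 2) * γ₀ * (W178 M L Nβ Rj d)⁻¹ * A₁ ^ 2 * p₁g ^ 2) * ∫ ω in R, w ω ∂μ := by
  set K : ℝ := Real.exp (1 / 2 * c177 C A₀ A₁ B₃ B₅ M Rj p₀g p₁g gj d) *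
    Real.exp (-(1 / 2) * γ₀ * (W178 M L Nβ Rj d)⁻¹ * A₁ ^ 2 * p₁g ^ 2) with hK
  have hK0 : 0 ≤ K := mul_nonneg (Real.exp_nonneg _) (Real.exp_nonneg _)
  have hpt : ∀ ω ∈ R, w ω * Real.exp (-(1 / 2) * Q ω) ≤ K * w ω := by
    intro ω hω
    have h := exp_neg_half_form_le hγ hW (h77 ω hω) (h78 ω hω) (hb ω hω)
    calc w ω * Real.exp (-(1 / 2) * Q ω) ≤ w ω * K := mul_le_mul_of_nonneg_left h (hw0 ω hω)
      _ = K * w ω := mul_comm _ _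
  have hrhs : ∫ ω in R, K * w ω ∂μ = K * ∫ ω in R, w ω ∂μ := integral_const_mul K w
  by_cases hfi : IntegrableOn (fun ω => w ω * Real.exp (-(1 / 2) * Q ω)) R μ
  · rw [← hrhs]
    exact setIntegral_mono_on hfi (hwi.const_mul K) hRm hpt
  · rw [integral_undef hfi]
    exact mul_nonneg hK0 (setIntegral_nonneg hRm hw0)

/-! ## §3. The printed comparisons: `< exp(−R_j^{−d−5}p₁²(g_j))` and `≦ exp(−p₀(g_j))` -/

/-- **p. 383, the display**: with the comparison of exponents `lfFactor178` (the printed `exp(−½γ₀W⁻¹A₁²p₁²(g_j)) <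
exp(−R_j^{−d−5}p₁²(g_j))` in the corrected `p₁²` reading — a hypothesis here; it is `…B16Sect1Kernels.lfFactor178_of_large`
under the explicit largeness `12(d+3)(100M(L+1)N^{β₀})^{d+2} < γ₀A₁²R_j³` of `R_j`) and a positive total weight, the case-2
factor is STRICTLY below `e^{½c}·exp(−R_j^{−d−5}p₁²(g_j))·∫_R w dμ`. PROVED. [cite: Balaban1989LargeFieldII, p.383 (after (1.78))] -/
theorem case2Integral_lt_printed (μ : Measure Ω) {R : Set Ω} (hRm : MeasurableSet R) {w Q ndB nb : Ω → ℝ}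
    {γ₀ C A₀ A₁ B₃ B₅ M L Nβ Rj p₀g p₁g gj : ℝ} {d : ℕ} (hγ : 0 ≤ γ₀) (hW : 0 < 100 * M * (L + 1) * Nβ * Rj)
    (hw0 : ∀ ω ∈ R, 0 ≤ w ω) (hwi : IntegrableOn w R μ) (hwpos : 0 < ∫ ω in R, w ω ∂μ)
    (h77 : ∀ ω ∈ R, Ineq177 (Q ω) (ndB ω) γ₀ C A₀ A₁ B₃ B₅ M Rj p₀g p₁g gj d)
    (h78 : ∀ ω ∈ R, Ineq178 (nb ω) (ndB ω) M L Nβ Rj d) (hb : ∀ ω ∈ R, (A₁ * p₁g) ^ 2 ≤ nb ω)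
    (hcmp : lfFactor178 γ₀ (W178 M L Nβ Rj d) A₁ (p₁g ^ 2) p₁g Rj d) :
    ∫ ω in R, w ω * Real.exp (-(1 / 2) * Q ω) ∂μ <
      Real.exp (1 / 2 * c177 C A₀ A₁ B₃ B₅ M Rj p₀g p₁g gj d) *
        Real.exp (-(Rj ^ (d + 5))⁻¹ * p₁g ^ 2) * ∫ ω in R, w ω ∂μ := by
  refine (case2Integral_le μ hRm hγ hW hw0 hwi h77 h78 hb).trans_lt ?_
  unfold lfFactor178 at hcmp
  have hcmp' : Real.exp (-(1 / 2) * γ₀ * (W178 M L Nβ Rj d)⁻¹ * A₁ ^ 2 * p₁g ^ 2) <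
      Real.exp (-(Rj ^ (d + 5))⁻¹ * p₁g ^ 2) := hcmp
  have hc : 0 < Real.exp (1 / 2 * c177 C A₀ A₁ B₃ B₅ M Rj p₀g p₁g gj d) := Real.exp_pos _
  exact mul_lt_mul_of_pos_right (mul_lt_mul_of_pos_left hcmp' hc) hwpos

/-- **p. 383, the final estimate** — *"We assume that 2p₁ − (d + 5)r₀ > p₀, and we estimate the factors by
exp(−p₀(g_j))"*: with `lfFactor178` and the exponent proviso in the `ℓ`-power reading of r13's
`exp_lfFactor_le_exp_neg_p0` (`p₀(g_j) = ℓ^{p₀}`, `p₁(g_j) = ℓ^{p₁}`, `R_j = ℓ^{r₀}`, `ℓ = log g_j⁻² ≧ 1`,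
`ExponentProviso383 p₀ p₁ r₀ d`), the case-2 factor is `≦ e^{½c}·exp(−p₀(g_j))·∫_R w dμ`. PROVED.
[cite: Balaban1989LargeFieldII, p.383 (after (1.78))] -/
theorem case2Integral_le_exp_neg_p0 (μ : Measure Ω) {R : Set Ω} (hRm : MeasurableSet R) {w Q ndB nb : Ω → ℝ}
    {γ₀ C A₀ A₁ B₃ B₅ M L Nβ Rj p₀g p₁g gj ℓ p₀ p₁ r₀ : ℝ} {d : ℕ} (hγ : 0 ≤ γ₀)
    (hW : 0 < 100 * M * (L + 1) * Nβ * Rj) (hw0 : ∀ ω ∈ R, 0 ≤ w ω) (hwi : IntegrableOn w R μ)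
    (h77 : ∀ ω ∈ R, Ineq177 (Q ω) (ndB ω) γ₀ C A₀ A₁ B₃ B₅ M Rj p₀g p₁g gj d)
    (h78 : ∀ ω ∈ R, Ineq178 (nb ω) (ndB ω) M L Nβ Rj d) (hb : ∀ ω ∈ R, (A₁ * p₁g) ^ 2 ≤ nb ω)
    (hcmp : lfFactor178 γ₀ (W178 M L Nβ Rj d) A₁ (p₁g ^ 2) p₁g Rj d)
    (hℓ : 1 ≤ ℓ) (hp₀ : p₀g = ℓ ^ p₀) (hp₁ : p₁g = ℓ ^ p₁) (hRℓ : Rj = ℓ ^ r₀)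
    (hprov : ExponentProviso383 p₀ p₁ r₀ d) :
    ∫ ω in R, w ω * Real.exp (-(1 / 2) * Q ω) ∂μ ≤
      Real.exp (1 / 2 * c177 C A₀ A₁ B₃ B₅ M Rj p₀g p₁g gj d) * Real.exp (-p₀g) * ∫ ω in R, w ω ∂μ := by
  refine (case2Integral_le μ hRm hγ hW hw0 hwi h77 h78 hb).trans ?_
  have h1 : Real.exp (-(1 / 2) * γ₀ * (W178 M L Nβ Rj d)⁻¹ * A₁ ^ 2 * p₁g ^ 2) ≤
      Real.exp (-(Rj ^ (d + 5))⁻¹ * p₁g ^ 2) := by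
    unfold lfFactor178 at hcmp; exact le_of_lt hcmp
  have h2 := exp_lfFactor_le_exp_neg_p0 hℓ hp₀ hp₁ hRℓ hprov
  have hw : 0 ≤ ∫ ω in R, w ω ∂μ := setIntegral_nonneg hRm hw0
  have hc : 0 ≤ Real.exp (1 / 2 * c177 C A₀ A₁ B₃ B₅ M Rj p₀g p₁g gj d) := Real.exp_nonneg _
  exact mul_le_mul_of_nonneg_right (mul_le_mul_of_nonneg_left (h1.trans h2) hc) hw

/-- The comparison hypothesis `hcmp` of the two theorems above DISCHARGED by the v5 theorem
`…B16Sect1Kernels.lfFactor178_of_large`: under the explicit largeness `12(d+3)(100M(L+1)N^{β₀})^{d+2} < γ₀A₁²R_j³` of `R_j`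
(«g_j sufficiently small») the case-2 factor is `< e^{½c}·exp(−R_j^{−d−5}p₁²(g_j))·∫_R w dμ` with no comparison hypothesis
left. PROVED. [cite: Balaban1989LargeFieldII, p.383 (after (1.78))] -/
theorem case2Integral_lt_printed_of_large (μ : Measure Ω) {R : Set Ω} (hRm : MeasurableSet R)
    {w Q ndB nb : Ω → ℝ} {γ₀ C A₀ A₁ B₃ B₅ M L Nβ Rj p₀g p₁g gj : ℝ} {d : ℕ} (hγ : 0 ≤ γ₀)
    (hM : 0 < 100 * M * (L + 1) * Nβ) (hRj : 0 < Rj) (hp : p₁g ≠ 0)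
    (hw0 : ∀ ω ∈ R, 0 ≤ w ω) (hwi : IntegrableOn w R μ) (hwpos : 0 < ∫ ω in R, w ω ∂μ)
    (h77 : ∀ ω ∈ R, Ineq177 (Q ω) (ndB ω) γ₀ C A₀ A₁ B₃ B₅ M Rj p₀g p₁g gj d)
    (h78 : ∀ ω ∈ R, Ineq178 (nb ω) (ndB ω) M L Nβ Rj d) (hb : ∀ ω ∈ R, (A₁ * p₁g) ^ 2 ≤ nb ω)
    (hlarge : 12 * (d + 3) * (100 * M * (L + 1) * Nβ) ^ (d + 2) < γ₀ * A₁ ^ 2 * Rj ^ 3) :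
    ∫ ω in R, w ω * Real.exp (-(1 / 2) * Q ω) ∂μ <
      Real.exp (1 / 2 * c177 C A₀ A₁ B₃ B₅ M Rj p₀g p₁g gj d) *
        Real.exp (-(Rj ^ (d + 5))⁻¹ * p₁g ^ 2) * ∫ ω in R, w ω ∂μ :=
  case2Integral_lt_printed μ hRm hγ (mul_pos hM hRj) hw0 hwi hwpos h77 h78 hb
    (lfFactor178_of_large hRj hp hM hlarge)

/-- *"so that the constant on the right-hand side above is small, or O(1)"* (p. 383): if `c ≦ 2 log K₀` (e.g. `c ≦ 1`
with `K₀ = e^{1/2}`), the prefactor `e^{½c}` is at most `K₀` — the harmless `O(1)` in front of the large field factor.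
PROVED (arithmetic). [cite: Balaban1989LargeFieldII, (1.77) p.383] -/
theorem prefactor_le {c K₀ : ℝ} (hK : 0 < K₀) (hc : c ≤ 2 * Real.log K₀) :
    Real.exp (1 / 2 * c) ≤ K₀ := by
  calc Real.exp (1 / 2 * c) ≤ Real.exp (Real.log K₀) := Real.exp_le_exp.mpr (by linarith)
    _ = K₀ := Real.exp_log hK

end

end Literature.MathematicalPhysics.QuantumFieldTheory.Balaban1983to89.B16Lem381Case2
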